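import Literature.Analysis.OperatorTheory.YangMillsMatrixModelRadialCutoff
import HarnessLib

/-!
# Agmon weights on `ℝ⁹`: the bracket `⟨x⟩ = √(1+‖x‖²)`, radial exponential weights `e^{φ(⟨x⟩)}` and weighted cut-offs

Topic `Literature/Analysis/OperatorTheory`, companion of `YangMillsMatrixModelRadialCutoff.lean` (the radial cut-off
`χ_R`, `‖∇χ_R‖² ≤ M₁`) and `YangMillsMatrixModelCutoffEnergy.lean` (Agmon's localisation identity
`𝔮(χF) = ∫ χ²F·𝔥F + ½∫‖∇χ‖²F²`), in the tree's vocabulary `ZM = ℝ⁹`, `pderiv p = ∂_p`, `gradient`, `IsTestFn = C²_c`.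

This is the first file of the DECAY step (Agmon 1982, Thm. 1.5 / Cor. 4.5) in the formalisation of the named fact
`LuscherHamiltonianEigenfunctions` (AL1): the weighted test functions `χ = η · e^{h}` with `h = φ(⟨x⟩)`,
`|φ'| ≤ L`, which are inserted into the localisation identity.  Contents (all proved):

* the bracket: `1 ≤ ⟨x⟩`, `‖x‖ ≤ ⟨x⟩ ≤ 1 + ‖x‖`, smoothness, `∂_p⟨x⟩ = x_p/⟨x⟩`, `Σ_p (∂_p⟨x⟩)² ≤ 1`;
* radial profiles: for `φ ∈ C²(ℝ)` with `|φ'| ≤ L`, `h = φ ∘ ⟨·⟩` is `C²` with `Σ_p (∂_p h)² ≤ L²`, and the weight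
  `w = e^{h}` is `C²` with `∂_p w = w ∂_p h`, `Σ_p (∂_p w)² ≤ L² w²`;
* weighted cut-offs: for a test function `η` and such a weight `w`, `χ = η w ∈ C²_c` and
  `‖∇χ‖² ≤ 2 w² ‖∇η‖² + 2 L² χ²`.

No named facts; no definitions (the bracket is written `√(1 + ‖x‖²)` throughout).

## References
* [Agmon1982] S. Agmon, *Lectures on Exponential Decay of Solutions of Second-Order Elliptic Equations*, Princeton Math.
  Notes 29 (1982), §1 (the weights `e^{h}` with `|∇h|² ≤ λ`), Thm. 1.5.
-/

noncomputable section

open MeasureTheory Filter Topology Function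
open scoped BigOperators

namespace Literature.Analysis.OperatorTheory.YMMatrixModel

section Bracket

/-! ### 1. The bracket `⟨x⟩ = √(1 + ‖x‖²)` -/

/-- `1 + ‖x‖² > 0`. [cite: Agmon1982, §1] -/
theorem one_add_norm_sq_pos (x : ZM) : 0 < 1 + ‖x‖ ^ 2 := by positivity

/-- `1 ≤ ⟨x⟩`. [cite: Agmon1982, §1] -/
theorem one_le_bracket (x : ZM) : 1 ≤ Real.sqrt (1 + ‖x‖ ^ 2) :=
  Real.one_le_sqrt.mpr (by nlinarith [norm_nonneg x])

/-- `0 < ⟨x⟩`. [cite: Agmon1982, §1] -/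
theorem bracket_pos (x : ZM) : 0 < Real.sqrt (1 + ‖x‖ ^ 2) := lt_of_lt_of_le one_pos (one_le_bracket x)

/-- `‖x‖ ≤ ⟨x⟩`. [cite: Agmon1982, §1] -/
theorem norm_le_bracket (x : ZM) : ‖x‖ ≤ Real.sqrt (1 + ‖x‖ ^ 2) :=
  (Real.le_sqrt (norm_nonneg x) (one_add_norm_sq_pos x).le).mpr (by linarith)

/-- `⟨x⟩ ≤ 1 + ‖x‖`. [cite: Agmon1982, §1] -/
theorem bracket_le_one_add_norm (x : ZM) : Real.sqrt (1 + ‖x‖ ^ 2) ≤ 1 + ‖x‖ := sqrt_one_add_norm_sq_le x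

/-- `⟨x⟩² = 1 + ‖x‖²`. [cite: Agmon1982, §1] -/
theorem bracket_sq (x : ZM) : Real.sqrt (1 + ‖x‖ ^ 2) ^ 2 = 1 + ‖x‖ ^ 2 :=
  Real.sq_sqrt (one_add_norm_sq_pos x).le

/-- The bracket is smooth. [cite: Agmon1982, §1] -/
theorem contDiff_bracket {n : WithTop ℕ∞} : ContDiff ℝ n fun x : ZM => Real.sqrt (1 + ‖x‖ ^ 2) :=
  (contDiff_const.add (contDiff_norm_sq ℝ)).sqrt fun x => (one_add_norm_sq_pos x).ne'

/-- The derivative of the bracket: `D⟨·⟩(x) = ⟨x⟩⁻¹ ⟪x, ·⟫`. [cite: Agmon1982, §1] -/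
theorem hasFDerivAt_bracket (x : ZM) :
    HasFDerivAt (fun y : ZM => Real.sqrt (1 + ‖y‖ ^ 2))
      ((1 / (2 * Real.sqrt (1 + ‖x‖ ^ 2))) • ((2 : ℕ) • innerSL ℝ x)) x := by
  have h1 : HasFDerivAt (fun y : ZM => 1 + ‖y‖ ^ 2) ((2 : ℕ) • innerSL ℝ x) x := by
    have := ((hasStrictFDerivAt_norm_sq x).hasFDerivAt).const_add 1
    simpa using this
  exact h1.sqrt (one_add_norm_sq_pos x).ne'

/-- `∂_p ⟨x⟩ = x_p / ⟨x⟩`. [cite: Agmon1982, §1] -/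
theorem pderiv_bracket (p : Fin 3 × Fin 3) (x : ZM) :
    pderiv p (fun y : ZM => Real.sqrt (1 + ‖y‖ ^ 2)) x = x p / Real.sqrt (1 + ‖x‖ ^ 2) := by
  rw [pderiv, (hasFDerivAt_bracket x).fderiv]
  have hin : inner ℝ x (unitDir p) = x p := by
    rw [unitDir, EuclideanSpace.inner_single_right]
    simp
  have h : 0 < Real.sqrt (1 + ‖x‖ ^ 2) := bracket_pos x
  simp [hin]
  field_simp

/-- `Σ_p (∂_p⟨x⟩)² = ‖x‖²/⟨x⟩² ≤ 1`. [cite: Agmon1982, §1] -/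
theorem sum_pderiv_bracket_sq_le (x : ZM) :
    ∑ p, (pderiv p (fun y : ZM => Real.sqrt (1 + ‖y‖ ^ 2)) x) ^ 2 ≤ 1 := by
  simp only [pderiv_bracket, div_pow]
  rw [← Finset.sum_div]
  have hn : ∑ p, x p ^ 2 = ‖x‖ ^ 2 := by
    rw [EuclideanSpace.real_norm_sq_eq]
  rw [hn, bracket_sq, div_le_one (one_add_norm_sq_pos x)]
  linarith

end Bracket

section Profile

/-! ### 2. Radial profiles `h = φ(⟨x⟩)` and the weights `w = e^{h}` -/

variable {φ : ℝ → ℝ} {L : ℝ}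

/-- `h = φ ∘ ⟨·⟩` is `C²` for `φ ∈ C²`. [cite: Agmon1982, §1] -/
theorem contDiff_profile (hφ : ContDiff ℝ 2 φ) : ContDiff ℝ 2 fun x : ZM => φ (Real.sqrt (1 + ‖x‖ ^ 2)) :=
  hφ.comp contDiff_bracket

/-- Chain rule: `∂_p (φ ∘ ⟨·⟩)(x) = φ'(⟨x⟩) · ∂_p⟨x⟩`. [cite: Agmon1982, §1] -/
theorem pderiv_profile (hφ : ContDiff ℝ 2 φ) (p : Fin 3 × Fin 3) (x : ZM) :
    pderiv p (fun y : ZM => φ (Real.sqrt (1 + ‖y‖ ^ 2))) x =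
      deriv φ (Real.sqrt (1 + ‖x‖ ^ 2)) * pderiv p (fun y : ZM => Real.sqrt (1 + ‖y‖ ^ 2)) x := by
  have hd : DifferentiableAt ℝ φ (Real.sqrt (1 + ‖x‖ ^ 2)) := (hφ.differentiable (by norm_num)) _
  have hc : HasFDerivAt (fun y : ZM => φ (Real.sqrt (1 + ‖y‖ ^ 2)))
      ((deriv φ (Real.sqrt (1 + ‖x‖ ^ 2))) • ((1 / (2 * Real.sqrt (1 + ‖x‖ ^ 2))) • ((2 : ℕ) • innerSL ℝ x))) x :=
    hd.hasDerivAt.comp_hasFDerivAt x (hasFDerivAt_bracket x)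
  rw [pderiv, hc.fderiv, pderiv, (hasFDerivAt_bracket x).fderiv]
  simp [smul_eq_mul]

/-- **`|∇h|² ≤ L²`** for `h = φ ∘ ⟨·⟩` with `|φ'| ≤ L`. [cite: Agmon1982, §1 (1.10)] -/
theorem sum_pderiv_profile_sq_le (hφ : ContDiff ℝ 2 φ) (hL : ∀ t, |deriv φ t| ≤ L) (x : ZM) :
    ∑ p, (pderiv p (fun y : ZM => φ (Real.sqrt (1 + ‖y‖ ^ 2))) x) ^ 2 ≤ L ^ 2 := by
  simp only [pderiv_profile hφ, mul_pow, ← Finset.mul_sum]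
  have h1 := sum_pderiv_bracket_sq_le x
  have h2 : deriv φ (Real.sqrt (1 + ‖x‖ ^ 2)) ^ 2 ≤ L ^ 2 := by
    have := hL (Real.sqrt (1 + ‖x‖ ^ 2))
    have hL0 : 0 ≤ L := (abs_nonneg _).trans this
    rw [← sq_abs]
    exact pow_le_pow_left₀ (abs_nonneg _) this 2
  have h3 : 0 ≤ ∑ p, (pderiv p (fun y : ZM => Real.sqrt (1 + ‖y‖ ^ 2)) x) ^ 2 :=
    Finset.sum_nonneg fun p _ => sq_nonneg _
  nlinarith

/-- The weight `w = e^{φ(⟨x⟩)}` is `C²`. [cite: Agmon1982, §1] -/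
theorem contDiff_weight (hφ : ContDiff ℝ 2 φ) :
    ContDiff ℝ 2 fun x : ZM => Real.exp (φ (Real.sqrt (1 + ‖x‖ ^ 2))) :=
  (contDiff_profile hφ).exp

/-- The weight is positive. [cite: Agmon1982, §1] -/
theorem weight_pos (φ : ℝ → ℝ) (x : ZM) : 0 < Real.exp (φ (Real.sqrt (1 + ‖x‖ ^ 2))) := Real.exp_pos _

/-- Chain rule: `∂_p e^{h} = e^{h} ∂_p h`. [cite: Agmon1982, §1] -/
theorem pderiv_weight (hφ : ContDiff ℝ 2 φ) (p : Fin 3 × Fin 3) (x : ZM) :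
    pderiv p (fun y : ZM => Real.exp (φ (Real.sqrt (1 + ‖y‖ ^ 2)))) x =
      Real.exp (φ (Real.sqrt (1 + ‖x‖ ^ 2))) * pderiv p (fun y : ZM => φ (Real.sqrt (1 + ‖y‖ ^ 2))) x := by
  have hd : DifferentiableAt ℝ (fun y : ZM => φ (Real.sqrt (1 + ‖y‖ ^ 2))) x :=
    ((contDiff_profile hφ).differentiable (by norm_num)) x
  rw [pderiv, (hd.hasFDerivAt.exp).fderiv, pderiv]
  simp [smul_eq_mul]

/-- **`|∇w|² ≤ L² w²`** for the weight `w = e^{φ(⟨x⟩)}`, `|φ'| ≤ L`. [cite: Agmon1982, §1 (1.10)] -/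
theorem sum_pderiv_weight_sq_le (hφ : ContDiff ℝ 2 φ) (hL : ∀ t, |deriv φ t| ≤ L) (x : ZM) :
    ∑ p, (pderiv p (fun y : ZM => Real.exp (φ (Real.sqrt (1 + ‖y‖ ^ 2)))) x) ^ 2 ≤
      L ^ 2 * Real.exp (φ (Real.sqrt (1 + ‖x‖ ^ 2))) ^ 2 := by
  simp only [pderiv_weight hφ, mul_pow, ← Finset.mul_sum]
  have h1 := sum_pderiv_profile_sq_le hφ hL x
  have h2 : 0 ≤ Real.exp (φ (Real.sqrt (1 + ‖x‖ ^ 2))) ^ 2 := sq_nonneg _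
  nlinarith

end Profile

section WeightedCutoff

/-! ### 3. Weighted cut-offs `χ = η · w` -/

variable {η w : ZM → ℝ}

/-- A test function times a `C²` function is a test function. [cite: Agmon1982, (1.16)] -/
theorem IsTestFn.mul_contDiff (hη : IsTestFn η) (hw : ContDiff ℝ 2 w) : IsTestFn (η * w) :=
  ⟨hη.1.mul hw, hη.2.mul_right⟩

/-- **Gradient of a weighted cut-off**: if `Σ_p (∂_p w)² ≤ L² w²` then
`‖∇(η w)‖² ≤ 2 w² ‖∇η‖² + 2 L² (η w)²`. [cite: Agmon1982, §1 (1.16)] -/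
theorem norm_gradient_sq_mul_le (hη : IsTestFn η) (hw : ContDiff ℝ 2 w) {L : ℝ}
    (hwL : ∀ x, ∑ p, (pderiv p w x) ^ 2 ≤ L ^ 2 * w x ^ 2) (x : ZM) :
    ‖gradient (η * w) x‖ ^ 2 ≤ 2 * w x ^ 2 * ‖gradient η x‖ ^ 2 + 2 * L ^ 2 * (η x * w x) ^ 2 := by
  rw [norm_gradient_sq, norm_gradient_sq]
  have hηd := hη.differentiable
  have hwd : Differentiable ℝ w := hw.differentiable (by norm_num)
  have hpt : ∀ p, (pderiv p (η * w) x) ^ 2 ≤ 2 * (w x ^ 2 * (pderiv p η x) ^ 2) + 2 * (η x ^ 2 * (pderiv p w x) ^ 2) := by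
    intro p
    rw [pderiv_mul hηd hwd p x]
    nlinarith [sq_nonneg (pderiv p η x * w x - η x * pderiv p w x)]
  calc ∑ p, (pderiv p (η * w) x) ^ 2
      ≤ ∑ p, (2 * (w x ^ 2 * (pderiv p η x) ^ 2) + 2 * (η x ^ 2 * (pderiv p w x) ^ 2)) :=
        Finset.sum_le_sum fun p _ => hpt p
    _ = 2 * w x ^ 2 * ∑ p, (pderiv p η x) ^ 2 + 2 * η x ^ 2 * ∑ p, (pderiv p w x) ^ 2 := by
        rw [Finset.sum_add_distrib, ← Finset.mul_sum, ← Finset.mul_sum, ← Finset.mul_sum, ← Finset.mul_sum]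
        ring
    _ ≤ 2 * w x ^ 2 * ∑ p, (pderiv p η x) ^ 2 + 2 * η x ^ 2 * (L ^ 2 * w x ^ 2) := by
        have := hwL x
        have h0 : 0 ≤ 2 * η x ^ 2 := by positivity
        nlinarith
    _ = 2 * w x ^ 2 * ∑ p, (pderiv p η x) ^ 2 + 2 * L ^ 2 * (η x * w x) ^ 2 := by ring

/-- The gradient of the radial cut-off vanishes on the open ball `‖x‖ < R` (where `χ_R ≡ 1`). [cite: Agmon1982, §1 (1.16)] -/
theorem gradient_radialCutoff_eq_zero {R : ℝ} (hR : 0 < R) {x : ZM} (hx : ‖x‖ < R) :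
    gradient (radialCutoff R) x = 0 := by
  have hev : (radialCutoff R) =ᶠ[𝓝 x] fun _ => (1 : ℝ) := by
    have hopen : IsOpen {y : ZM | ‖y‖ < R} := isOpen_lt continuous_norm continuous_const
    filter_upwards [hopen.mem_nhds hx] with y hy
    exact radialCutoff_eq_one_of_lt hR hy
  rw [gradient, hev.fderiv_eq]
  simp

/-- **The weighted radial cut-off package** `χ = χ_R · w`, `w = e^{φ(⟨·⟩)}`, `|φ'| ≤ L`, `R ≥ 1`, with the tree's
`radialCutoff R`: `χ ∈ C²_c`; `χ = w` on `‖x‖ < R`; `0 ≤ χ ≤ w`; the raw gradient bound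
`‖∇χ‖² ≤ 2 w² ‖∇χ_R‖² + 2 L² χ²` together with `‖∇χ_R‖² ≤ M₁` (one `M₁` for all `R ≥ 1`) and `∇χ_R = 0` on `‖x‖ < R`.
[cite: Agmon1982, §1 (1.16)] -/
theorem weightedCutoff_package {φ : ℝ → ℝ} {L : ℝ} (hφ : ContDiff ℝ 2 φ) (hL : ∀ t, |deriv φ t| ≤ L) :
    ∃ M : ℝ, 0 ≤ M ∧ ∀ R : ℝ, 1 ≤ R →
      IsTestFn (radialCutoff R * fun y : ZM => Real.exp (φ (Real.sqrt (1 + ‖y‖ ^ 2)))) ∧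
      (∀ x : ZM, ‖x‖ < R →
        (radialCutoff R * fun y : ZM => Real.exp (φ (Real.sqrt (1 + ‖y‖ ^ 2)))) x =
          Real.exp (φ (Real.sqrt (1 + ‖x‖ ^ 2)))) ∧
      (∀ x : ZM, 0 ≤ (radialCutoff R * fun y : ZM => Real.exp (φ (Real.sqrt (1 + ‖y‖ ^ 2)))) x) ∧
      (∀ x : ZM, (radialCutoff R * fun y : ZM => Real.exp (φ (Real.sqrt (1 + ‖y‖ ^ 2)))) x ≤
        Real.exp (φ (Real.sqrt (1 + ‖x‖ ^ 2)))) ∧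
      (∀ x : ZM, ‖gradient (radialCutoff R * fun y : ZM => Real.exp (φ (Real.sqrt (1 + ‖y‖ ^ 2)))) x‖ ^ 2 ≤
        2 * Real.exp (φ (Real.sqrt (1 + ‖x‖ ^ 2))) ^ 2 * ‖gradient (radialCutoff R) x‖ ^ 2 +
          2 * L ^ 2 * ((radialCutoff R * fun y : ZM => Real.exp (φ (Real.sqrt (1 + ‖y‖ ^ 2)))) x) ^ 2) ∧
      (∀ x : ZM, ‖gradient (radialCutoff R) x‖ ^ 2 ≤ M) ∧
      (∀ x : ZM, ‖x‖ < R → gradient (radialCutoff R) x = 0) := by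
  obtain ⟨M₁, hM0, hM⟩ := radialCutoff_package
  refine ⟨M₁, hM0, fun R hR => ?_⟩
  have hR0 : 0 < R := lt_of_lt_of_le one_pos hR
  obtain ⟨hη, -, hone, -, hgrad⟩ := hM R hR
  set w : ZM → ℝ := fun y => Real.exp (φ (Real.sqrt (1 + ‖y‖ ^ 2))) with hw_def
  have hwC : ContDiff ℝ 2 w := contDiff_weight hφ
  have h01 : ∀ x, radialCutoff R x ∈ Set.Icc (0 : ℝ) 1 := radialCutoff_mem_Icc R
  refine ⟨hη.mul_contDiff hwC, fun x hx => ?_, fun x => ?_, fun x => ?_, fun x => ?_, hgrad,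
    fun x hx => gradient_radialCutoff_eq_zero hR0 hx⟩
  · show radialCutoff R x * w x = w x
    rw [hone x hx, one_mul]
  · exact mul_nonneg (h01 x).1 (Real.exp_pos _).le
  · show radialCutoff R x * w x ≤ w x
    have := (h01 x).2
    have hw0 : 0 < w x := Real.exp_pos _
    nlinarith
  · exact norm_gradient_sq_mul_le hη hwC (sum_pderiv_weight_sq_le hφ hL) x

end WeightedCutoff

end Literature.Analysis.OperatorTheory.YMMatrixModel

end
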